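import Mathlib
import HarnessLib

/-!
# Uniform congruence counting for the continued-fractions semigroup (Magee–Oh–Winter 2019)

M. Magee, H. Oh, D. Winter, *Uniform congruence counting for Schottky semigroups in `SL₂(𝐙)`*
(with an appendix by J. Bourgain, A. Kontorovich, M. Magee), J. reine angew. Math. 753 (2019)
89–135 = arXiv:1601.03705 [MageeOhWinter2019].

For a finite set `A` of at least two positive integers let `𝒢_A ⊆ GL₂(ℤ)` be the semigroup
generated by the matrices `g_a = (0 1; 1 a)`, `a ∈ A`, and `Γ_A := 𝒢_A ∩ SL₂(ℤ)` — "in other words,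
`Γ_A` is a semigroup generated by `{g_a g_{a'} : a, a' ∈ A}`" (§1), the *continued fractions
semigroup*. Let `δ_A > 0` be the Hausdorff dimension of the limit set of `Γ_A` (the accumulation
points of an orbit `Γ_A · o`, `o ∈ ℍ`; §1). Theorem 1 (Schottky semigroups) with Theorem 2 ("Theorem 1
also holds for the continued fractions semigroup `Γ_A`") give `Q₀ ∈ ℕ`, `c > 0`, `C > 0`, `ε > 0`
with `#(Γ_A(q) ∩ B_R) = c R^{2δ_A} / #SL₂(ℤ/qℤ) + O(q^C R^{2δ_A - ε})` for all `q` coprime to `Q₀`,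
`B_R` the Frobenius-norm ball; the elaborated Main Theorem 11 (with weight `G ≡ 1` and shift
`γ₀ = e`) gives the same count in EVERY residue class `ξ ∈ Γ_q := SL₂(ℤ/qℤ)`, uniformly in `ξ`
(the extension from square-free to arbitrary `q` coprime to `Q₀` is the appendix, Thm. 37).

## Contents

* `cfGen a = !![0, 1; 1, a]`, `cfSemigroup A` (the set `Γ_A` of nonempty even products, as integer
  matrices), with `det = 1` (`det_of_mem_cfSemigroup`) and closure under products proved;
* `cfLimitSet A ⊆ ℂ` (accumulation points of the orbit of `i ∈ ℍ`), `cfDimension A = dim_H`;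
* `cfCount A q ξ R = #{γ ∈ Γ_A : ‖γ‖_F ≤ R, γ ≡ ξ (mod q)}`;
* the named fact `MageeOhWinter2019_uniformCounting` and its unpacking at `q = 1`
  (`MageeOhWinter2019_uniformCounting.total`, proved from the fact).

## Design notes / faithfulness

* We record the `G ≡ 1`, `γ₀ = e` case of Thm. 11 for `Γ_A` (Thm. 2 asserts that the results
  hold for `Γ_A`), which is what route `ABC/ThinOrbitABC` (item `GoodModuliLevel`) consumes. With
  `γ₀ = e` the printed ball is `‖γ‖/‖e‖ = ‖γ‖/√2 ≤ R`; we use the closed Frobenius ball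
  `‖γ‖_F ≤ R` (Thm. 1 uses the open ball `‖γ‖_F < R`): rescaling `R` and passing between open and
  closed balls only changes the constant `c` and the implied constant (footnote to eq. (5) of §3),
  both of which are existentially quantified here, so the statement below is implied by the printed
  one. The implied constant is made explicit as `K` and the bound is required for all `R ≥ 1`
  (for bounded `R` both sides are `O_A(1) ≤ K q^C R^{2δ-ε}`).
* `δ_A` is DEFINED as printed: the Hausdorff dimension (Mathlib `dimH`, computed in `ℂ`) of the set
  of accumulation points (Mathlib `derivedSet`) of the orbit `Γ_A · i ⊆ ℍ ⊆ ℂ`; for `Γ_A` this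
  orbit is bounded in `ℂ` (it lies over `[0, 1]`), so no accumulation at `∞` is lost. Its
  identification with the dimension of the Cantor set `E_A = {[0; a₁, a₂, …] : aᵢ ∈ A}` (Hensley)
  is standard but not needed and not asserted.
* Counting is over ELEMENTS of `Γ_A ⊆ SL₂(ℤ)` (matrices), as in `#(Γ(q) ∩ B_R)`.

## References

* M. Magee, H. Oh, D. Winter, J. reine angew. Math. 753 (2019) 89–135, arXiv:1601.03705: Thm. 1,
  Thm. 2 (p. 3), Thm. 11 (p. 8–9), appendix Thm. 37 (p. 23). [MageeOhWinter2019]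
-/

noncomputable section

open scoped MatrixGroups

namespace Literature.NumberTheory.Sieve

/-! ### The continued fractions semigroup `Γ_A` -/

/-- The generator `g_a = (0 1; 1 a) ∈ GL₂(ℤ)` (`det g_a = -1`), acting on `ℍ ∪ ℝ` by
`z ↦ 1/(z + a)`. [cite: MageeOhWinter2019, §1] -/
def cfGen (a : ℕ) : Matrix (Fin 2) (Fin 2) ℤ := !![0, 1; 1, (a : ℤ)]

/-- `det g_a = -1`. [cite: MageeOhWinter2019, §1] -/
theorem det_cfGen (a : ℕ) : (cfGen a).det = -1 := by
  simp [cfGen, Matrix.det_fin_two_of]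

/-- The **continued fractions semigroup** `Γ_A = 𝒢_A ∩ SL₂(ℤ)`: the products
`g_{a₁} g_{a₂} ⋯ g_{a₂ₖ}` (`k ≥ 1`, `aᵢ ∈ A`) of a positive EVEN number of generators, i.e. the
semigroup generated by `{g_a g_{a'} : a, a' ∈ A}`, as a set of integer matrices (all of determinant
`1`, `det_of_mem_cfSemigroup`). [cite: MageeOhWinter2019, §1 (definition of Γ_A)] -/
def cfSemigroup (A : Finset ℕ) : Set (Matrix (Fin 2) (Fin 2) ℤ) :=
  {M | ∃ w : List ℕ, w ≠ [] ∧ Even w.length ∧ (∀ a ∈ w, a ∈ A) ∧ (w.map cfGen).prod = M}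

/-- The determinant of a product of generators is `(-1)^{length}`. [cite: MageeOhWinter2019, §1] -/
theorem det_prod_map_cfGen (w : List ℕ) : ((w.map cfGen).prod).det = (-1) ^ w.length := by
  induction w with
  | nil => simp
  | cons a w ih => rw [List.map_cons, List.prod_cons, Matrix.det_mul, ih, det_cfGen,
      List.length_cons, pow_succ, mul_comm]

/-- Elements of `Γ_A` have determinant `1` (`Γ_A ⊆ SL₂(ℤ)`). [cite: MageeOhWinter2019, §1] -/
theorem det_of_mem_cfSemigroup {A : Finset ℕ} {M : Matrix (Fin 2) (Fin 2) ℤ}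
    (hM : M ∈ cfSemigroup A) : M.det = 1 := by
  obtain ⟨w, -, heven, -, rfl⟩ := hM
  rw [det_prod_map_cfGen, heven.neg_one_pow]

/-- `Γ_A` is closed under multiplication (it is a semigroup). [cite: MageeOhWinter2019, §1] -/
theorem mul_mem_cfSemigroup {A : Finset ℕ} {M N : Matrix (Fin 2) (Fin 2) ℤ}
    (hM : M ∈ cfSemigroup A) (hN : N ∈ cfSemigroup A) : M * N ∈ cfSemigroup A := by
  obtain ⟨w, hw, hwe, hwA, rfl⟩ := hM
  obtain ⟨v, -, hve, hvA, rfl⟩ := hN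
  refine ⟨w ++ v, by simp [hw], ?_, ?_, by rw [List.map_append, List.prod_append]⟩
  · rw [List.length_append]
    exact hwe.add hve
  · intro a ha
    rcases List.mem_append.1 ha with h | h
    exacts [hwA a h, hvA a h]

/-- The generating products `g_a g_{a'}`, `a, a' ∈ A`, lie in `Γ_A`. [cite: MageeOhWinter2019, §1] -/
theorem cfGen_mul_cfGen_mem {A : Finset ℕ} {a b : ℕ} (ha : a ∈ A) (hb : b ∈ A) :
    cfGen a * cfGen b ∈ cfSemigroup A :=
  ⟨[a, b], by simp, by simp, by simp [ha, hb], by simp⟩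

/-! ### Limit set, dimension, congruence counts -/

/-- The **limit set** of `Γ_A`: the accumulation points in `ℂ` of the orbit `Γ_A · i` of the base
point `i ∈ ℍ` under the Möbius action of `Γ_A ⊆ SL₂(ℤ)` (§1: "the set of all accumulation points of
an orbit `Γ.o`"; for `Γ_A` the orbit lies over `[0, 1]`, so it does not accumulate at `∞`).
[cite: MageeOhWinter2019, §1] -/
def cfLimitSet (A : Finset ℕ) : Set ℂ :=
  derivedSet {z : ℂ | ∃ γ : SL(2, ℤ), (γ : Matrix (Fin 2) (Fin 2) ℤ) ∈ cfSemigroup A ∧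
    z = ((γ • UpperHalfPlane.I : UpperHalfPlane) : ℂ)}

/-- `δ_A`: the Hausdorff dimension of the limit set of `Γ_A` (a real number in `[0, 2]`).
[cite: MageeOhWinter2019, §1] -/
def cfDimension (A : Finset ℕ) : ℝ := (dimH (cfLimitSet A)).toReal

/-- The congruence count `#{γ ∈ Γ_A : ‖γ‖_F ≤ R, γ ≡ ξ (mod q)}` — elements of `Γ_A ⊆ SL₂(ℤ)` in
the closed Frobenius ball of radius `R` (`a² + b² + c² + d² ≤ R²`) reducing to `ξ ∈ SL₂(ℤ/qℤ)`.
[cite: MageeOhWinter2019, §1 and §3] -/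
def cfCount (A : Finset ℕ) (q : ℕ) (ξ : SL(2, ZMod q)) (R : ℝ) : ℕ :=
  Set.ncard {γ : SL(2, ℤ) | (γ : Matrix (Fin 2) (Fin 2) ℤ) ∈ cfSemigroup A ∧
    (∑ i, ∑ j, (((γ : Matrix (Fin 2) (Fin 2) ℤ) i j : ℤ) : ℝ) ^ 2) ≤ R ^ 2 ∧
    Matrix.SpecialLinearGroup.map (Int.castRingHom (ZMod q)) γ = ξ}

/-! ### The named fact -/

/-- **Magee–Oh–Winter uniform congruence counting for `Γ_A`** (Thm. 1 & Thm. 2; Thm. 11 with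
`G ≡ 1`, `γ₀ = e`; appendix Thm. 37 for arbitrary moduli). For every finite set `A` of at least two
positive integers there are `Q₀ ∈ ℕ`, `c > 0`, `C > 0`, `ε > 0` and an implied constant `K` such
that `δ_A > 0` and, for every `q ≥ 1` coprime to `Q₀`, every residue class
`ξ ∈ Γ_q = SL₂(ℤ/qℤ)` and every `R ≥ 1`,
`| #{γ ∈ Γ_A : ‖γ‖_F ≤ R, γ ≡ ξ (q)} - c R^{2δ_A} / #SL₂(ℤ/qℤ) | ≤ K q^C R^{2δ_A - ε}`.
See the module docstring for the (harmless) ball normalisation. [cite: MageeOhWinter2019, Thm. 1, Thm. 2 and Thm. 11] -/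
def MageeOhWinter2019_uniformCounting : Prop :=
  ∀ A : Finset ℕ, (∀ a ∈ A, 1 ≤ a) → 2 ≤ A.card →
    0 < cfDimension A ∧
    ∃ Q₀ : ℕ, 0 < Q₀ ∧ ∃ c : ℝ, 0 < c ∧ ∃ C : ℝ, 0 < C ∧ ∃ ε : ℝ, 0 < ε ∧ ∃ K : ℝ, 0 ≤ K ∧
      ∀ q : ℕ, 0 < q → Nat.Coprime q Q₀ → ∀ (ξ : SL(2, ZMod q)) (R : ℝ), 1 ≤ R →
        |(cfCount A q ξ R : ℝ) - c * R ^ (2 * cfDimension A) / (Nat.card (SL(2, ZMod q)) : ℝ)| ≤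
          K * (q : ℝ) ^ C * R ^ (2 * cfDimension A - ε)

/-! ### Unpacking at level `q = 1`: the total count `N(R) = c R^{2δ_A} + O(R^{2δ_A - ε})` -/

/-- `SL₂(ℤ/1ℤ)` is the trivial group. [folklore] -/
theorem natCard_specialLinearGroup_zmod_one : Nat.card (SL(2, ZMod 1)) = 1 := by
  haveI : Subsingleton (SL(2, ZMod 1)) := ⟨fun a b => Subtype.ext (Subsingleton.elim _ _)⟩
  exact Nat.card_of_subsingleton (1 : SL(2, ZMod 1))

/-- The total count: at `q = 1` (coprime to everything, `#SL₂(ℤ/1ℤ) = 1`, one residue class) the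
fact reads `| #{γ ∈ Γ_A : ‖γ‖_F ≤ R} - c R^{2δ_A} | ≤ K R^{2δ_A - ε}` for `R ≥ 1` — Hensley/Lalley-type
asymptotics `N_A(R) ~ c R^{2δ_A}` with a power saving. [cite: MageeOhWinter2019, Thm. 2] -/
theorem MageeOhWinter2019_uniformCounting.total (h : MageeOhWinter2019_uniformCounting)
    {A : Finset ℕ} (hA : ∀ a ∈ A, 1 ≤ a) (hcard : 2 ≤ A.card) :
    ∃ c : ℝ, 0 < c ∧ ∃ ε : ℝ, 0 < ε ∧ ∃ K : ℝ, 0 ≤ K ∧ ∀ R : ℝ, 1 ≤ R →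
      |(cfCount A 1 1 R : ℝ) - c * R ^ (2 * cfDimension A)| ≤
        K * R ^ (2 * cfDimension A - ε) := by
  obtain ⟨-, Q₀, -, c, hc, C, -, ε, hε, K, hK, hmain⟩ := h A hA hcard
  refine ⟨c, hc, ε, hε, K, hK, fun R hR => ?_⟩
  have h1 := hmain 1 Nat.one_pos (Nat.coprime_one_left Q₀) 1 R hR
  rw [natCard_specialLinearGroup_zmod_one] at h1
  simpa only [Nat.cast_one, div_one, Real.one_rpow, mul_one] using h1

end Literature.NumberTheory.Sieve
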